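import Literature.AlgebraicGeometry.RelativeSpec.EquivariantModuleDescentUnique
import Literature.AlgebraicGeometry.Modules.EquivariantStructureRestrictOfPullback
import Literature.AlgebraicGeometry.Modules.RankOneEndomorphismScalar
import Literature.AlgebraicGeometry.Modules.PullbackQuasicoherent
import Literature.AlgebraicGeometry.Modules.RankOneDescentAlongH0Iso
import HarnessLib

/-!
# The discrepancy of an isomorphism `p^* F₁ ≅ p^* F₀` against the canonical linearisations, and descent of the isomorphism

Layer `Literature/AlgebraicGeometry/RelativeSpec`, namespace `Literature.AlgebraicGeometry.RelativeSpec.ActionOver`.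
THEOREMS ONLY (no definition, no named fact, no instance, no notation).  Sequel to ★ (T1)
`RelativeSpec/EquivariantModuleDescent`, ★ (T2) `RelativeSpec/EquivariantModuleDescentUnique`, ★
`Modules/EquivariantStructure(Restrict)(OfPullback)` and ★ `Modules/RankOneEndomorphismScalar`.

Setting: `ρ : ActionOver p G`, `p : X ⟶ Q`; modules `F₀, F₁, …` on `Q` and an isomorphism `e : p^* F₁ ≅ p^* F₀` of
their inverse images.  Each `p^* Fᵢ` carries the canonical `G`-linearisation ★ `EquivariantStructure.ofPullback ρ Fᵢ`
(`can_g : σ_g^* p^* Fᵢ ≅ p^* Fᵢ`); [MumfordAV1970] §12 Thm. 1 / [MumfordFogartyKirwan1994] Prop. 7.1: `F ↦ (p^*F, can)` is an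
equivalence for a free finite quotient, so `e` comes from an isomorphism `F₁ ≅ F₀` iff it INTERTWINES the two `can`'s.
When `p^* F₀` is a line bundle the failure to intertwine is measured, for each `g`, by a GLOBAL FUNCTION `r_g ∈ Γ(X, 𝒪_X)`
(the DISCREPANCY): `σ_g^*(e) ≫ can⁰_g = can¹_g ≫ e ≫ (r_g · 𝟙)` (★ `exists_unique_eq_globalScalar`: endomorphisms of a line
bundle are global functions).  This file proves, WITHOUT defining the discrepancy as data (it is the `r` of an `∃!`):

* §1 `existsUnique_discrepancy` — existence and uniqueness of `r_g` (`HasRank F₀ 1`); `discrepancy_refl` (`e = 𝟙 ⇒ r = 1`);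
  `ofPullback_iso_hom_naturality` + **`discrepancy_conj`** (A6) — the `can`'s are natural in the module, so conjugating
  `e` by isomorphisms `p^*j₁`, `p^*j₀` pulled back from `Q` does not change the discrepancies;
* §2 **`exists_iso_of_discrepancy_eq`** — two isomorphisms `e : p^*F₁ ≅ p^*F₀`, `e′ : p^*F₂ ≅ p^*F₀` with THE SAME
  discrepancies `r_g` come from an isomorphism `F₁ ≅ F₂` over `p^*F₀` (★ T2 `descent_unique_of_free` for the structure
  `(ofPullback ρ F₁).ofIso e` on `p^* F₀`; `p` an affine flat geometric quotient by a free action), and the corollary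
  **`exists_iso_of_discrepancy_eq_one`** — if all `r_g = 1` then `F₁ ≅ F₀` under `e`;
* §3 `discrepancy_one`, **`discrepancy_mul`** — if the `r_g` are `G`-INVARIANT functions (`σ_h^♯ r_g = r_g`, e.g. pulled
  back from the base of a `G`-morphism) then `r_1 = 1` and `r_{gh} = r_g r_h` (the cocycle identities `iso_one`/`iso_mul` of
  the two canonical linearisations + ★ `globalScalar_comp` / `pullback_map_globalScalar`), hence `r_g ^ n = 1` whenever
  `g ^ n = 1` (`discrepancy_pow_eq_one`);
* §4 **`discrepancy_restrict`** — along an equivariant commuting square `ι ≫ p = p′ ≫ κ` (★ `restrictAlong_ofPullback`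
  currency) the isomorphism `e′ := squareIso⁻¹ ≫ ι^* e ≫ squareIso : p′^* κ^* F₁ ≅ p′^* κ^* F₀` has discrepancies `ι^♯ r_g`.

Consumer: the EXISTENCE half of the universal property of the dual pair of a quotient abelian scheme `A/K`
([MumfordAV1970] §15 Thm. 1; cell `hodgecm-mathlib`, HECKE-LINK D6 (u1)+(u2): the character correction of the `[n]`-division is
read through these discrepancies for the `K`-translation action over `ψ_T : A_T → (A/K)_T`).  Count-neutral; HC_CM is proved
only modulo the 7 printed citations until rung 0 closes — nothing here is about HC.

## References
* [MumfordAV1970] D. Mumford, *Abelian Varieties* (1970), §7 Prop. 2 (p. 70), §12 Thm. 1 (p. 112), §15 Thm. 1 (p. 143).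
* [MumfordFogartyKirwan1994] D. Mumford, J. Fogarty, F. Kirwan, *GIT*, 3rd ed., Ch. 1 §3 Def. 1.6 (p. 30), Prop. 7.1.
* [Greither1992CyclicGalois] C. Greither, LNM 1534 (1992), Ch. 0 Thm. 7.1, Prop. 7.2 (pp. 28–29).
* [Hartshorne1977] R. Hartshorne, *Algebraic Geometry*, II Ex. 5.1 (b) (p. 123).
-/

set_option autoImplicit false

noncomputable section

-- `TopCat.Presheaf`/`Scheme.Modules` are not reducible (as in Mathlib's `AlgebraicGeometry/Modules`).
set_option backward.isDefEq.respectTransparency false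

universe u

open CategoryTheory Limits AlgebraicGeometry TopologicalSpace Opposite
open Literature.AlgebraicGeometry.Modules Literature.AlgebraicGeometry.Motives

namespace Literature.AlgebraicGeometry.RelativeSpec.ActionOver

section Main

variable {X Q : Scheme.{u}} {p : X ⟶ Q} {G : Type u} [Group G] (ρ : ActionOver p G)
  (F₀ F₁ F₂ : Q.Modules)
  (e : (Scheme.Modules.pullback p).obj F₁ ≅ (Scheme.Modules.pullback p).obj F₀)
  (e' : (Scheme.Modules.pullback p).obj F₂ ≅ (Scheme.Modules.pullback p).obj F₀)

/-! ## §1 The discrepancy scalars -/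

/-- **Existence and uniqueness of the discrepancy.**  If `p^* F₀` is a line bundle then for every `g` there is a unique
global function `r ∈ Γ(X, 𝒪_X)` with `σ_g^*(e) ≫ can⁰_g = can¹_g ≫ e ≫ (r · 𝟙)` — the endomorphism
`(can¹_g ≫ e)⁻¹ ≫ σ_g^*(e) ≫ can⁰_g` of the line bundle `p^* F₀` is a global function (★ `exists_unique_eq_globalScalar`).
[cite: Hartshorne1977, II Ex. 5.1 (b) (p. 123)] [cite: MumfordAV1970, §12 Thm. 1 (p. 112)] -/
theorem existsUnique_discrepancy (h₀ : HasRank ((Scheme.Modules.pullback p).obj F₀) 1) (g : G) :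
    ∃! r : Γ(X, ⊤), (Scheme.Modules.pullback (ρ.autHom g)).map e.hom ≫
        ((EquivariantStructure.ofPullback ρ F₀).iso g).hom =
      ((EquivariantStructure.ofPullback ρ F₁).iso g).hom ≫ e.hom ≫
        globalScalar ((Scheme.Modules.pullback p).obj F₀) r := by
  obtain ⟨a, ha, huniq⟩ := exists_unique_eq_globalScalar h₀
    (e.inv ≫ ((EquivariantStructure.ofPullback ρ F₁).iso g).inv ≫
      (Scheme.Modules.pullback (ρ.autHom g)).map e.hom ≫ ((EquivariantStructure.ofPullback ρ F₀).iso g).hom)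
  refine ⟨a, ?_, fun b hb => huniq b ?_⟩
  · beta_reduce
    rw [← ha]
    simp only [Iso.hom_inv_id_assoc]
  · beta_reduce at hb ⊢
    rw [hb]
    simp only [Iso.inv_hom_id_assoc]

/-- The identity `p^* F₀ ≅ p^* F₀` has discrepancy `1`. [cite: MumfordAV1970, §12 Thm. 1 (p. 112)] -/
theorem discrepancy_refl (g : G) :
    (Scheme.Modules.pullback (ρ.autHom g)).map (Iso.refl ((Scheme.Modules.pullback p).obj F₀)).hom ≫
        ((EquivariantStructure.ofPullback ρ F₀).iso g).hom =
      ((EquivariantStructure.ofPullback ρ F₀).iso g).hom ≫ (Iso.refl ((Scheme.Modules.pullback p).obj F₀)).hom ≫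
        globalScalar ((Scheme.Modules.pullback p).obj F₀) 1 := by
  rw [globalScalar_one, Iso.refl_hom, CategoryTheory.Functor.map_id, Category.id_comp, Category.id_comp, Category.comp_id]

/-- **The canonical linearisation of an inverse image is natural in the module**: for `φ : F ⟶ F′` on `Q`,
`σ_g^*(p^*φ) ≫ can′_g = can_g ≫ p^*φ` (naturality of Mathlib's `pullbackComp` / `pullbackCongr`).
[cite: MumfordAV1970, §7 Prop. 2 (p. 70)] [cite: MumfordFogartyKirwan1994, Ch. 1 §3 Definition 1.6 (p. 30)] -/
@[reassoc]
theorem ofPullback_iso_hom_naturality {F F' : Q.Modules} (φ : F ⟶ F') (g : G) :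
    (Scheme.Modules.pullback (ρ.autHom g)).map ((Scheme.Modules.pullback p).map φ) ≫
        ((EquivariantStructure.ofPullback ρ F').iso g).hom =
      ((EquivariantStructure.ofPullback ρ F).iso g).hom ≫ (Scheme.Modules.pullback p).map φ := by
  have h₁ := (Scheme.Modules.pullbackComp (ρ.autHom g) p).hom.naturality φ
  have h₂ := (Scheme.Modules.pullbackCongr (ρ.autHom_comp g)).hom.naturality φ
  simp only [Functor.comp_map] at h₁
  simp only [EquivariantStructure.ofPullback, Iso.trans_hom, Iso.app_hom, Category.assoc]
  rw [reassoc_of% h₁, h₂]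

/-- **(A6) Naturality of the discrepancy in the modules**: for isomorphisms `j₀ : F₀ ≅ F₀′`, `j₁ : F₁′ ≅ F₁` downstairs,
the conjugated isomorphism `p^*j₁ ≫ e ≫ p^*j₀ : p^* F₁′ ≅ p^* F₀′` has THE SAME discrepancies as `e` (the canonical
linearisations are natural in the module, `ofPullback_iso_hom_naturality`, and `p^*j₀` commutes with global scalars).
[cite: MumfordAV1970, §12 Thm. 1 (p. 112)] [cite: MumfordFogartyKirwan1994, Ch. 1 §3 Definition 1.6 (p. 30)] -/
theorem discrepancy_conj {F₀' F₁' : Q.Modules} (j₀ : F₀ ≅ F₀') (j₁ : F₁' ≅ F₁) (r : Γ(X, ⊤)) (g : G)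
    (he : (Scheme.Modules.pullback (ρ.autHom g)).map e.hom ≫ ((EquivariantStructure.ofPullback ρ F₀).iso g).hom =
      ((EquivariantStructure.ofPullback ρ F₁).iso g).hom ≫ e.hom ≫
        globalScalar ((Scheme.Modules.pullback p).obj F₀) r) :
    (Scheme.Modules.pullback (ρ.autHom g)).map
          ((Scheme.Modules.pullback p).mapIso j₁ ≪≫ e ≪≫ (Scheme.Modules.pullback p).mapIso j₀).hom ≫
        ((EquivariantStructure.ofPullback ρ F₀').iso g).hom =
      ((EquivariantStructure.ofPullback ρ F₁').iso g).hom ≫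
        ((Scheme.Modules.pullback p).mapIso j₁ ≪≫ e ≪≫ (Scheme.Modules.pullback p).mapIso j₀).hom ≫
          globalScalar ((Scheme.Modules.pullback p).obj F₀') r := by
  simp only [Iso.trans_hom, Functor.mapIso_hom, CategoryTheory.Functor.map_comp, Category.assoc]
  rw [ofPullback_iso_hom_naturality, reassoc_of% he, ofPullback_iso_hom_naturality_assoc, globalScalar_comp]

/-! ## §2 Equal discrepancies ⇒ the modules on the quotient are isomorphic -/

variable [Fintype G] [IsAffineHom p] [Flat p]

/-- **Two isomorphisms onto `p^* F₀` with the same discrepancies come from an isomorphism `F₁ ≅ F₂`** (over `p^* F₀`).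
For `p` an affine flat geometric quotient by a free action, `F₀` quasi-coherent with `p^*F₀` of rank one... no rank
hypothesis is needed here: the common scalars `r_g` are automatically automorphisms.  Mechanism: ★ T2
`descent_unique_of_free` for the linearisation `(ofPullback ρ F₁).ofIso e` of `p^* F₀`, with which `e` is compatible by
construction and `e′` by the hypothesis. [cite: Greither1992CyclicGalois, Ch. 0 Prop. 7.2 (p. 29)]
[cite: MumfordAV1970, §12 Thm. 1 (p. 112)] -/
theorem exists_iso_of_discrepancy_eq (hq : ρ.IsGeometricQuotient p)
    (hfree : ∀ (V : Q.Opens), IsAffineOpen V → ∀ g : G, g ≠ 1 →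
      Ideal.span (Set.range fun b : Γ(X, p ⁻¹ᵁ V) ↦ ρ.act g V b - b) = ⊤)
    [F₀.IsQuasicoherent] (r : G → Γ(X, ⊤))
    (he : ∀ g : G, (Scheme.Modules.pullback (ρ.autHom g)).map e.hom ≫
        ((EquivariantStructure.ofPullback ρ F₀).iso g).hom =
      ((EquivariantStructure.ofPullback ρ F₁).iso g).hom ≫ e.hom ≫
        globalScalar ((Scheme.Modules.pullback p).obj F₀) (r g))
    (he' : ∀ g : G, (Scheme.Modules.pullback (ρ.autHom g)).map e'.hom ≫
        ((EquivariantStructure.ofPullback ρ F₀).iso g).hom =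
      ((EquivariantStructure.ofPullback ρ F₂).iso g).hom ≫ e'.hom ≫
        globalScalar ((Scheme.Modules.pullback p).obj F₀) (r g)) :
    ∃ i : F₁ ≅ F₂, (Scheme.Modules.pullback p).map i.hom ≫ e'.hom = e.hom := by
  -- the linearisation of `p^* F₀` transported from the canonical one of `p^* F₁` along `e`
  let Φ : ρ.EquivariantStructure ((Scheme.Modules.pullback p).obj F₀) := (EquivariantStructure.ofPullback ρ F₁).ofIso e
  -- the common scalars are automorphisms
  have hS : ∀ g : G, globalScalar ((Scheme.Modules.pullback p).obj F₀) (r g) =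
      e.inv ≫ ((EquivariantStructure.ofPullback ρ F₁).iso g).inv ≫
        (Scheme.Modules.pullback (ρ.autHom g)).map e.hom ≫ ((EquivariantStructure.ofPullback ρ F₀).iso g).hom := by
    intro g
    rw [he g]
    simp only [Iso.inv_hom_id_assoc]
  haveI hSiso : ∀ g : G, IsIso (globalScalar ((Scheme.Modules.pullback p).obj F₀) (r g)) := by
    intro g; rw [hS g]; infer_instance
  haveI : ((Scheme.Modules.pullback p).obj F₀).IsQuasicoherent := isQuasicoherent_pullback p F₀
  refine descent_unique_of_free ρ ((Scheme.Modules.pullback p).obj F₀) Φ.iso hq hfree Φ.iso_one_hom Φ.iso_mul_hom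
    F₁ F₂ e e' (fun g => ?_) (fun g => ?_)
  · -- `e` is compatible by construction
    change (Scheme.Modules.pullback (ρ.autHom g)).map e.hom ≫
        ((Scheme.Modules.pullback (ρ.autHom g)).map e.inv ≫ ((EquivariantStructure.ofPullback ρ F₁).iso g).hom ≫
          e.hom) = ((EquivariantStructure.ofPullback ρ F₁).iso g).hom ≫ e.hom
    rw [← CategoryTheory.Functor.map_comp_assoc, Iso.hom_inv_id, CategoryTheory.Functor.map_id, Category.id_comp]
  · -- `e'` is compatible because its discrepancies agree with those of `e`
    change (Scheme.Modules.pullback (ρ.autHom g)).map e'.hom ≫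
        ((Scheme.Modules.pullback (ρ.autHom g)).map e.inv ≫ ((EquivariantStructure.ofPullback ρ F₁).iso g).hom ≫
          e.hom) = ((EquivariantStructure.ofPullback ρ F₂).iso g).hom ≫ e'.hom
    rw [← cancel_mono (globalScalar ((Scheme.Modules.pullback p).obj F₀) (r g))]
    simp only [Category.assoc]
    rw [← he' g, hS g]
    simp only [Iso.hom_inv_id_assoc, Iso.map_inv_hom_id_assoc]

/-- **An isomorphism `p^* F₁ ≅ p^* F₀` with trivial discrepancies descends**: if all `r_g = 1` (i.e. `e` intertwines the
canonical linearisations) then `F₁ ≅ F₀` under `e`. [cite: MumfordAV1970, §12 Thm. 1 (p. 112)]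
[cite: Greither1992CyclicGalois, Ch. 0 Prop. 7.2 (p. 29)] -/
theorem exists_iso_of_discrepancy_eq_one (hq : ρ.IsGeometricQuotient p)
    (hfree : ∀ (V : Q.Opens), IsAffineOpen V → ∀ g : G, g ≠ 1 →
      Ideal.span (Set.range fun b : Γ(X, p ⁻¹ᵁ V) ↦ ρ.act g V b - b) = ⊤)
    [F₀.IsQuasicoherent]
    (he : ∀ g : G, (Scheme.Modules.pullback (ρ.autHom g)).map e.hom ≫
        ((EquivariantStructure.ofPullback ρ F₀).iso g).hom =
      ((EquivariantStructure.ofPullback ρ F₁).iso g).hom ≫ e.hom ≫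
        globalScalar ((Scheme.Modules.pullback p).obj F₀) 1) :
    ∃ i : F₁ ≅ F₀, (Scheme.Modules.pullback p).map i.hom = e.hom := by
  obtain ⟨i, hi⟩ := exists_iso_of_discrepancy_eq ρ F₀ F₁ F₀ e (Iso.refl _) hq hfree (fun _ => 1) he
    (fun g => discrepancy_refl ρ F₀ g)
  exact ⟨i, by simpa only [Iso.refl_hom, Category.comp_id] using hi⟩

end Main

/-! ## §3 Invariant discrepancies are multiplicative -/

section Naturality

variable {X Q : Scheme.{u}} {p : X ⟶ Q} {G : Type u} [Group G] (ρ : ActionOver p G)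

/-- Naturality of `σ_1^* E ≅ E` in the module. [cite: MumfordFogartyKirwan1994, Ch. 1 §3 Definition 1.6 (p. 30)] -/
@[reassoc]
private theorem pullbackOneIso_hom_naturality {E E' : X.Modules} (φ : E ⟶ E') :
    (Scheme.Modules.pullback (ρ.autHom 1)).map φ ≫ (ρ.pullbackOneIso E').hom = (ρ.pullbackOneIso E).hom ≫ φ := by
  have h₁ := (Scheme.Modules.pullbackCongr ρ.autHom_one).hom.naturality φ
  have h₂ := (Scheme.Modules.pullbackId X).hom.naturality φ
  simp only [Functor.id_map] at h₂
  simp only [ActionOver.pullbackOneIso, Iso.trans_hom, Iso.app_hom, Category.assoc]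
  rw [reassoc_of% h₁, h₂]

/-- Naturality of `σ_{gh}^* E ≅ σ_h^* σ_g^* E` in the module.
[cite: MumfordFogartyKirwan1994, Ch. 1 §3 Definition 1.6 (p. 30)] -/
@[reassoc]
private theorem pullbackMulIso_hom_naturality {E E' : X.Modules} (φ : E ⟶ E') (g h : G) :
    (Scheme.Modules.pullback (ρ.autHom (g * h))).map φ ≫ (ρ.pullbackMulIso g h E').hom =
      (ρ.pullbackMulIso g h E).hom ≫
        (Scheme.Modules.pullback (ρ.autHom h)).map ((Scheme.Modules.pullback (ρ.autHom g)).map φ) := by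
  have h₁ := (Scheme.Modules.pullbackCongr (ρ.autHom_mul g h)).hom.naturality φ
  have h₂ := (Scheme.Modules.pullbackComp (ρ.autHom h) (ρ.autHom g)).inv.naturality φ
  simp only [Functor.comp_map] at h₂
  simp only [ActionOver.pullbackMulIso, Iso.trans_hom, Iso.app_hom, Iso.symm_hom, Iso.app_inv, Category.assoc]
  rw [reassoc_of% h₁, h₂]

end Naturality

section Mul

variable {X Q : Scheme.{u}} {p : X ⟶ Q} {G : Type u} [Group G] (ρ : ActionOver p G)
  (F₀ F₁ : Q.Modules)
  (e : (Scheme.Modules.pullback p).obj F₁ ≅ (Scheme.Modules.pullback p).obj F₀)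
  (h₀ : HasRank ((Scheme.Modules.pullback p).obj F₀) 1) (r : G → Γ(X, ⊤))
  (he : ∀ g : G, (Scheme.Modules.pullback (ρ.autHom g)).map e.hom ≫
      ((EquivariantStructure.ofPullback ρ F₀).iso g).hom =
    ((EquivariantStructure.ofPullback ρ F₁).iso g).hom ≫ e.hom ≫
      globalScalar ((Scheme.Modules.pullback p).obj F₀) (r g))

include h₀ he in
/-- **`r_1 = 1`** (the two `can_1` are the canonical `σ_1^* = 𝟙^*` isomorphisms, natural in the module).
[cite: MumfordFogartyKirwan1994, Ch. 1 §3 Definition 1.6 (p. 30)] -/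
theorem discrepancy_one : r 1 = 1 := by
  refine eq_of_globalScalar_eq Nat.one_pos h₀ ?_
  have h1 := he 1
  rw [(EquivariantStructure.ofPullback ρ F₀).iso_one, (EquivariantStructure.ofPullback ρ F₁).iso_one,
    pullbackOneIso_hom_naturality] at h1
  rw [globalScalar_one, ← cancel_epi (((ρ.pullbackOneIso ((Scheme.Modules.pullback p).obj F₁))).hom ≫ e.hom),
    Category.comp_id, Category.assoc]
  exact h1.symm

include h₀ he in
/-- **`r_{gh} = r_g · r_h` for `G`-invariant discrepancies** (`σ_h^♯ r_g = r_g`): expand both `can_{gh}` by the cocycle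
identity `iso_mul`, move `σ_h^*(r_g · 𝟙) = (σ_h^♯ r_g) · 𝟙 = r_g · 𝟙` (★ `pullback_map_globalScalar`) past `can⁰_h`
(★ `globalScalar_comp`), and conclude by uniqueness of the discrepancy. [cite: MumfordFogartyKirwan1994, Ch. 1 §3 Definition 1.6 (p. 30)]
[cite: MumfordAV1970, §12 Thm. 1 (p. 112)] -/
theorem discrepancy_mul (hinv : ∀ g h : G, (ρ.autHom h).appTop (r g) = r g) (g h : G) : r (g * h) = r g * r h := by
  obtain ⟨a, -, huniq⟩ := existsUnique_discrepancy ρ F₀ F₁ e h₀ (g * h)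
  refine (huniq _ (he (g * h))).trans (huniq _ ?_).symm
  -- expand both `can_{gh}` by the cocycle identity and move the scalars to the right
  rw [(EquivariantStructure.ofPullback ρ F₀).iso_mul, (EquivariantStructure.ofPullback ρ F₁).iso_mul]
  simp only [Iso.trans_hom, Functor.mapIso_hom, Category.assoc]
  rw [pullbackMulIso_hom_naturality_assoc, ← CategoryTheory.Functor.map_comp_assoc, he g, CategoryTheory.Functor.map_comp_assoc,
    CategoryTheory.Functor.map_comp_assoc, pullback_map_globalScalar, hinv, globalScalar_comp, reassoc_of% (he h),
    globalScalar_mul]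

include h₀ he in
/-- Hence `r_g ^ n = 1` whenever `g ^ n = 1` (invariant discrepancies). [cite: MumfordAV1970, §12 Thm. 1 (p. 112)] -/
theorem discrepancy_pow_eq_one (hinv : ∀ g h : G, (ρ.autHom h).appTop (r g) = r g) {g : G} {n : ℕ} (hg : g ^ n = 1) :
    r g ^ n = 1 := by
  have hpow : ∀ k : ℕ, r (g ^ k) = r g ^ k := by
    intro k
    induction k with
    | zero => rw [pow_zero, pow_zero]; exact discrepancy_one ρ F₀ F₁ e h₀ r he
    | succ k ih => rw [pow_succ, pow_succ, discrepancy_mul ρ F₀ F₁ e h₀ r he hinv, ih]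
  rw [← hpow, hg]
  exact discrepancy_one ρ F₀ F₁ e h₀ r he

end Mul

/-! ## §4 Discrepancies restrict along an equivariant square -/

section Restrict

variable {X X' Q Q' : Scheme.{u}} {p : X ⟶ Q} {p' : X' ⟶ Q'} {G : Type u} [Group G]
  (ρ : ActionOver p G) (τ : ActionOver p' G) (ι : X' ⟶ X) (κ : Q' ⟶ Q) (hsq : ι ≫ p = p' ≫ κ)
  (hι : ∀ g : G, τ.autHom g ≫ ι = ι ≫ ρ.autHom g)
  (F₀ F₁ : Q.Modules) (h₀ : HasRank F₀ 1) (h₁ : HasRank F₁ 1)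
  (e : (Scheme.Modules.pullback p).obj F₁ ≅ (Scheme.Modules.pullback p).obj F₀)
  (r : G → Γ(X, ⊤))
  (he : ∀ g : G, (Scheme.Modules.pullback (ρ.autHom g)).map e.hom ≫
      ((EquivariantStructure.ofPullback ρ F₀).iso g).hom =
    ((EquivariantStructure.ofPullback ρ F₁).iso g).hom ≫ e.hom ≫
      globalScalar ((Scheme.Modules.pullback p).obj F₀) (r g))

include hι h₀ h₁ he in
/-- **Discrepancies restrict**: along a commuting square `ι ≫ p = p′ ≫ κ` compatible with the actions
(`τ_g ≫ ι = ι ≫ σ_g`), the restricted isomorphism `squareIso⁻¹ ≫ ι^* e ≫ squareIso : p′^* κ^* F₁ ≅ p′^* κ^* F₀` has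
discrepancies `ι^♯ r_g` against the canonical linearisations of `τ` (★ `restrictAlong_ofPullback`: «the canonical
linearisation restricts to the canonical linearisation», ★ `squareIso_hom_naturality`, ★ `pullback_map_globalScalar`).
[cite: MumfordAV1970, §7 Prop. 2 (p. 70)] [cite: MumfordFogartyKirwan1994, Ch. 1 §3 Definition 1.6 (p. 30)] -/
theorem discrepancy_restrict (g : G) :
    (Scheme.Modules.pullback (τ.autHom g)).map
          ((squareIso hsq F₁).symm ≪≫ (Scheme.Modules.pullback ι).mapIso e ≪≫ squareIso hsq F₀).hom ≫
        ((EquivariantStructure.ofPullback τ ((Scheme.Modules.pullback κ).obj F₀)).iso g).hom =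
      ((EquivariantStructure.ofPullback τ ((Scheme.Modules.pullback κ).obj F₁)).iso g).hom ≫
        ((squareIso hsq F₁).symm ≪≫ (Scheme.Modules.pullback ι).mapIso e ≪≫ squareIso hsq F₀).hom ≫
          globalScalar ((Scheme.Modules.pullback p').obj ((Scheme.Modules.pullback κ).obj F₀)) (ι.appTop (r g)) := by
  -- «the canonical linearisation restricts to the canonical linearisation», for `F₀` and for `F₁`
  have k₀ := restrictAlong_ofPullback ρ τ ι κ hsq hι (HasRank.isFiniteLocallyFree' h₀) g
  have k₁ := restrictAlong_ofPullback ρ τ ι κ hsq hι (HasRank.isFiniteLocallyFree' h₁) g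
  simp only [restrictAlong] at k₀ k₁
  -- `canτ_g = τ_g^*(sq⁻¹) ≫ sq' ≫ ι^*(can_g) ≫ sq`
  have k₀' : ((EquivariantStructure.ofPullback τ ((Scheme.Modules.pullback κ).obj F₀)).iso g).hom =
      (Scheme.Modules.pullback (τ.autHom g)).map (squareIso hsq F₀).inv ≫
        (squareIso (hι g) ((Scheme.Modules.pullback p).obj F₀)).hom ≫
          (Scheme.Modules.pullback ι).map ((EquivariantStructure.ofPullback ρ F₀).iso g).hom ≫
            (squareIso hsq F₀).hom := by
    rw [← Category.assoc _ _ (squareIso hsq F₀).hom, k₀, ← CategoryTheory.Functor.map_comp_assoc, Iso.inv_hom_id, CategoryTheory.Functor.map_id,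
      Category.id_comp]
  have k₁' : ((EquivariantStructure.ofPullback τ ((Scheme.Modules.pullback κ).obj F₁)).iso g).hom ≫
      (squareIso hsq F₁).inv =
      (Scheme.Modules.pullback (τ.autHom g)).map (squareIso hsq F₁).inv ≫
        (squareIso (hι g) ((Scheme.Modules.pullback p).obj F₁)).hom ≫
          (Scheme.Modules.pullback ι).map ((EquivariantStructure.ofPullback ρ F₁).iso g).hom := by
    rw [← cancel_epi ((Scheme.Modules.pullback (τ.autHom g)).map (squareIso hsq F₁).hom), ← Category.assoc, ← k₁,
      ← CategoryTheory.Functor.map_comp_assoc, Iso.hom_inv_id, CategoryTheory.Functor.map_id, Category.id_comp, Category.assoc, Category.assoc,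
      Iso.hom_inv_id, Category.comp_id]
  simp only [Iso.trans_hom, Iso.symm_hom, Functor.mapIso_hom, CategoryTheory.Functor.map_comp, Category.assoc]
  rw [k₀', ← CategoryTheory.Functor.map_comp_assoc _ (squareIso hsq F₀).hom, Iso.hom_inv_id, CategoryTheory.Functor.map_id, Category.id_comp,
    squareIso_hom_naturality_assoc (hι g) e.hom, ← CategoryTheory.Functor.map_comp_assoc _ _ ((EquivariantStructure.ofPullback ρ F₀).iso g).hom,
    he g, CategoryTheory.Functor.map_comp_assoc, CategoryTheory.Functor.map_comp_assoc, pullback_map_globalScalar, globalScalar_comp,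
    reassoc_of% k₁']

end Restrict

end Literature.AlgebraicGeometry.RelativeSpec.ActionOver

end
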